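import Summits.ResolutionOfSingularities.ResolutionOfSingularities.Theorems.PurelyInseparableDim4InScopeWinCert
import Summits.ResolutionOfSingularities.ResolutionOfSingularities.Theorems.PurelyInseparableDim4Equivariance
import Summits.ResolutionOfSingularities.ResolutionOfSingularities.Theorems.PurelyInseparableDim4ScopeDescent
import HarnessLib
import HarnessLib.Audit.Tags

/-!
# Purely inseparable fourfolds — SCOPE and ISOLATION are `S₄`-INVARIANT; the F4-C attractor mod `S₄` and
# under base change   [OURS · counted 0 · frame bookkeeping, not about resolution]

Census cell «res-dim4-pi» (D-0157 DOOR 2), width seat `res-dim4-p-14`, brick PR-12v.  The census engines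
count states, cycles and traps MODULO the renaming group `S₄` of the coordinates, in the frame-v4 columns
(F4-C `InCoordinateScope`, F4-I `IsIsolated`) as everywhere else; res-dim4-p-6's `Equivariance` gives the
`S₄`-equivariance of the game (`step_rename`, `edge_rename`, `isPermissibleCentre_rename_iff`) and PR-12k
(`EscapableInvariance`) that of the ESCAPABLE column.  This file supplies the missing kernel statements for the
v4 columns:

* §1 `hasseDeriv_rename` (the frame's `D^{(α)}` is `S₄`-equivariant), `singLocusIdeal_rename`
  (`J_q⁺(e F) = e J_q⁺(F)`), transport of `𝔪₀`, of coordinate ideals and of minimal primes under `rename e`;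
* §2 **`inCoordinateScope_rename_iff`**, **`isIsolated_rename_iff`** — IN SCOPE / BLIND / ISOLATED are
  `S₄`-invariant letters;
* §3 **`inScopeStateWins_rename_iff`** — the F4-C attractor (`InScopeWinCert.InScopeStateWins`) is
  `S₄`-invariant; **`inScopeStateWins_of_inScopeStateWins_map`** — it DESCENDS along field maps `k → K`
  (uses both directions of «in scope is geometric»: `ScopeBaseChange.inCoordinateScope_map` UP and
  `ScopeDescent.inCoordinateScope_of_map` DOWN); `isolatedChain_rename` — F4-I kill certificates mod `S₄`.

So an in-scope trap / an in-scope win certificate / an isolated chain may be quoted up to renaming, and an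
in-scope trap found over `𝔽₂` kills F4-C over every field of characteristic 2 containing it (while in-scope
escapability over `𝔽₂` says nothing upstairs).  Nothing here proves resolution of singularities in dimension
≥ 4 / characteristic `p`; counted 0; AI work, weaker than expert review.
bears_on: LADDER-RESOLUTION:D157-DOOR2 (res-dim4-pi · PR-12v). Supports stmt-ResolutionOfSingularities-16155
(helper).
-/

set_option linter.dupNamespace false

noncomputable section

open MvPolynomial

namespace Summit.ResolutionOfSingularities.ResolutionOfSingularities.Theorems.PIDim4

namespace ScopeSymmetry

open Literature.AlgebraicGeometry.Resolution

variable {K : Type} [Field K] (e : Equiv.Perm (Fin 4))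

/-! ## 1. `rename e` and the data of the `q`-fold locus -/

/-- Renaming preserves the degree of an exponent. [folklore] -/
theorem degree_mapDomain_perm (β : Fin 4 →₀ ℕ) : (β.mapDomain e).degree = β.degree := by
  rw [Finsupp.degree_eq_sum, Finsupp.degree_eq_sum]
  conv_lhs => rw [← Equiv.sum_comp e]
  simp only [Equivariance.mapDomain_apply_perm]

/-- Renaming commutes with truncated subtraction of exponents. [folklore] -/
theorem mapDomain_tsub_perm (d β : Fin 4 →₀ ℕ) :
    (d - β).mapDomain e = d.mapDomain e - β.mapDomain e := by
  ext i
  obtain ⟨j, rfl⟩ := e.surjective i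
  rw [Finsupp.tsub_apply, Equivariance.mapDomain_apply_perm, Equivariance.mapDomain_apply_perm,
    Equivariance.mapDomain_apply_perm, Finsupp.tsub_apply]

/-- `(e⁻¹ α) e = α`. [folklore] -/
theorem mapDomain_symm_mapDomain (α : Fin 4 →₀ ℕ) : (α.mapDomain e.symm).mapDomain e = α := by
  rw [← Finsupp.mapDomain_comp, Equiv.self_comp_symm, Finsupp.mapDomain_id]

/-- **The frame's Hasse derivative is `S₄`-equivariant**: `D^{(eβ)}(e F) = e (D^{(β)} F)`.
[cite: EGAIV4, Thm. 16.11.2 (16.11.2.1)] [folklore] -/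
theorem hasseDeriv_rename (β : Fin 4 →₀ ℕ) (F : MvPolynomial (Fin 4) K) :
    hasseDeriv (β.mapDomain e) (rename e F) = rename e (hasseDeriv β F) := by
  unfold hasseDeriv
  rw [map_sum, support_rename_of_injective e.injective,
    Finset.sum_image fun x _ y _ h => Finsupp.mapDomain_injective e.injective h]
  refine Finset.sum_congr rfl fun d _ => ?_
  rw [rename_monomial, mapDomain_tsub_perm, coeff_rename_mapDomain e e.injective]
  congr 2
  rw [← Equiv.prod_comp e]
  simp only [Equivariance.mapDomain_apply_perm]

/-- **`J_q⁺(e F) = e J_q⁺(F)`.** [folklore] -/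
theorem singLocusIdeal_rename (q : ℕ) (F : MvPolynomial (Fin 4) K) :
    singLocusIdeal q (rename e F) = (singLocusIdeal q F).map (rename e) := by
  unfold singLocusIdeal
  rw [Ideal.map_span]
  congr 1
  ext G
  constructor
  · rintro ⟨α, h0, hq, rfl⟩
    refine ⟨hasseDeriv (α.mapDomain e.symm) F, ⟨α.mapDomain e.symm, ?_, ?_, rfl⟩, ?_⟩
    · rwa [degree_mapDomain_perm]
    · rwa [degree_mapDomain_perm]
    · rw [← hasseDeriv_rename, mapDomain_symm_mapDomain]
  · rintro ⟨_, ⟨β, h0, hq, rfl⟩, rfl⟩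
    refine ⟨β.mapDomain e, ?_, ?_, ?_⟩
    · rwa [degree_mapDomain_perm]
    · rwa [degree_mapDomain_perm]
    · exact (hasseDeriv_rename e β F).symm

/-- `e⁻¹ (e F) = F`. [folklore] -/
theorem rename_symm_rename_apply (F : MvPolynomial (Fin 4) K) : rename e.symm (rename e F) = F := by
  rw [rename_rename, Equiv.symm_comp_self, rename_id_apply]

/-- `e (e⁻¹ F) = F`. [folklore] -/
theorem rename_rename_symm_apply (F : MvPolynomial (Fin 4) K) : rename e (rename e.symm F) = F := by
  rw [rename_rename, Equiv.self_comp_symm, rename_id_apply]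

/-- `I.map (rename e) = I.comap (rename e⁻¹)`. [folklore] -/
theorem map_rename_eq_comap (I : Ideal (MvPolynomial (Fin 4) K)) :
    I.map (rename e) = I.comap (rename e.symm) := by
  apply le_antisymm
  · rw [Ideal.map_le_iff_le_comap]
    intro x hx
    rw [Ideal.mem_comap, Ideal.mem_comap, rename_symm_rename_apply]
    exact hx
  · intro x hx
    rw [Ideal.mem_comap] at hx
    rw [← rename_rename_symm_apply e x]
    exact Ideal.mem_map_of_mem _ hx

/-- `(I.map (rename e)).map (rename e⁻¹) = I`. [folklore] -/
theorem map_rename_map_symm (I : Ideal (MvPolynomial (Fin 4) K)) :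
    (I.map (rename e)).map (rename e.symm) = I := by
  rw [map_rename_eq_comap e.symm, Equiv.symm_symm, map_rename_eq_comap]
  ext F
  rw [Ideal.mem_comap, Ideal.mem_comap, rename_symm_rename_apply]

/-- `Ideal.map (rename e)` reflects inclusions. [folklore] -/
theorem le_of_map_rename_le {I J : Ideal (MvPolynomial (Fin 4) K)} (h : I.map (rename e) ≤ J.map (rename e)) :
    I ≤ J := by
  have := Ideal.map_mono (f := rename e.symm) h
  rwa [map_rename_map_symm, map_rename_map_symm] at this

/-- `𝔪₀` is `S₄`-stable. [folklore] -/
theorem originIdeal_map_rename : (originIdeal K).map (rename e) = originIdeal K := by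
  rw [map_rename_eq_comap]
  ext F
  simp only [originIdeal, Ideal.mem_comap, RingHom.mem_ker, eval_rename]
  rfl

/-- `(x_S).map (rename e) = (x_{e S})`. [folklore] -/
theorem span_X_map_rename (S : Finset (Fin 4)) :
    (Ideal.span ((fun i => (X i : MvPolynomial (Fin 4) K)) '' (S : Set (Fin 4)))).map (rename e) =
      Ideal.span ((fun i => (X i : MvPolynomial (Fin 4) K)) ''
        ((S.map e.toEmbedding : Finset (Fin 4)) : Set (Fin 4))) := by
  rw [Ideal.map_span, ← Set.image_comp, Finset.coe_map, ← Set.image_comp]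
  congr 1
  ext G
  simp only [Set.mem_image, Function.comp_apply, Equiv.coe_toEmbedding]
  constructor
  · rintro ⟨i, hi, rfl⟩; exact ⟨i, hi, (rename_X e i).symm⟩
  · rintro ⟨i, hi, rfl⟩; exact ⟨i, hi, rename_X e i⟩

/-- Coordinate ideals go to coordinate ideals, and only they. [folklore] -/
theorem isCoordinateIdeal_map_rename_iff (P : Ideal (MvPolynomial (Fin 4) K)) :
    IsCoordinateIdeal (P.map (rename e)) ↔ IsCoordinateIdeal P := by
  constructor
  · rintro ⟨S, hS⟩
    refine ⟨S.map e.symm.toEmbedding, ?_⟩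
    rw [← map_rename_map_symm e P, hS, span_X_map_rename]
  · rintro ⟨S, rfl⟩
    exact ⟨S.map e.toEmbedding, span_X_map_rename e S⟩

/-- Minimal primes move with `rename e`. [folklore] -/
theorem minimalPrimes_map_rename (I : Ideal (MvPolynomial (Fin 4) K)) :
    (I.map (rename e)).minimalPrimes = Ideal.map (rename e) '' I.minimalPrimes := by
  rw [map_rename_eq_comap]
  have h := Ideal.comap_minimalPrimes_eq_of_surjective
    (f := (rename e.symm : MvPolynomial (Fin 4) K →ₐ[K] MvPolynomial (Fin 4) K).toRingHom)
    (fun x => rename_surjective _ e.symm.surjective x) I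
  exact h.trans (Set.image_congr fun P _ => (map_rename_eq_comap e P).symm)

/-! ## 2. IN SCOPE and ISOLATED are `S₄`-invariant -/

/-- **IN COORDINATE SCOPE is `S₄`-invariant** (hence so is BLIND). [folklore] -/
theorem inCoordinateScope_rename_iff (q : ℕ) (F : MvPolynomial (Fin 4) K) :
    InCoordinateScope q (rename e F) ↔ InCoordinateScope q F := by
  unfold InCoordinateScope
  rw [singLocusIdeal_rename, minimalPrimes_map_rename]
  constructor
  · intro h P hP hP0
    have h1 := h (P.map (rename e)) ⟨P, hP, rfl⟩
      (by rw [← originIdeal_map_rename e]; exact Ideal.map_mono hP0)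
    exact (isCoordinateIdeal_map_rename_iff e P).mp h1
  · rintro h _ ⟨P, hP, rfl⟩ hP0
    refine (isCoordinateIdeal_map_rename_iff e P).mpr (h P hP ?_)
    rw [← originIdeal_map_rename e] at hP0
    exact le_of_map_rename_le e hP0

/-- **ISOLATED is `S₄`-invariant.** [folklore] -/
theorem isIsolated_rename_iff (q : ℕ) (F : MvPolynomial (Fin 4) K) :
    IsIsolated q (rename e F) ↔ IsIsolated q F := by
  unfold IsIsolated
  rw [singLocusIdeal_rename, minimalPrimes_map_rename]
  refine and_congr ⟨fun h => ?_, fun h => ?_⟩ ⟨fun h P hP hP0 => ?_, ?_⟩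
  · rw [← originIdeal_map_rename e] at h
    exact le_of_map_rename_le e h
  · rw [← originIdeal_map_rename e]
    exact Ideal.map_mono h
  · have h1 := h (P.map (rename e)) ⟨P, hP, rfl⟩
      (by rw [← originIdeal_map_rename e]; exact Ideal.map_mono hP0)
    have h2 := congrArg (Ideal.map (rename e.symm)) h1
    rwa [map_rename_map_symm, originIdeal_map_rename] at h2
  · rintro h _ ⟨P, hP, rfl⟩ hP0
    rw [← originIdeal_map_rename e] at hP0
    rw [h P hP (le_of_map_rename_le e hP0), originIdeal_map_rename]

/-! ## 3. The F4-C attractor mod `S₄` and under base change; isolated chains mod `S₄` -/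

section Attractor

variable [DecidableEq K]

open InScopeWinCert

/-- In-scope escapable states rename to in-scope escapable states. [folklore] -/
theorem inScopeStateWins_rename (q : ℕ) {s : State K} (h : InScopeStateWins q s) :
    InScopeStateWins q (s.rename e) := by
  unfold InScopeStateWins at h ⊢
  induction h with
  | @terminal s hs =>
    refine Game.Wins.terminal fun S hS => hs (S.map e.symm.toEmbedding) ⟨?_, ?_⟩
    · exact (inCoordinateScope_rename_iff e q s.F).mp hS.1
    · rw [← Equivariance.isPermissibleCentre_rename_iff e, Equivariance.map_symm_map]
      exact hS.2
  | @move s S hS _ ih =>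
    refine Game.Wins.move (m := S.map e.toEmbedding)
      ⟨(inCoordinateScope_rename_iff e q s.F).mpr hS.1,
        (Equivariance.isPermissibleCentre_rename_iff e q S s.F).mpr hS.2⟩ fun t' ht' => ?_
    have hback := Equivariance.edge_rename e.symm ht'
    rw [Equivariance.rename_rename_symm] at hback
    have hS' : (S.map e.toEmbedding).map e.symm.toEmbedding = S := by
      have h1 := Equivariance.map_symm_map e.symm S
      rwa [Equiv.symm_symm] at h1
    rw [hS'] at hback
    have hw := ih (t'.rename e.symm) hback
    have ht : (t'.rename e.symm).rename e = t' := by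
      have h2 := Equivariance.rename_rename_symm e.symm t'
      rwa [Equiv.symm_symm] at h2
    rwa [ht] at hw

/-- **The F4-C attractor is `S₄`-invariant.** [folklore] -/
theorem inScopeStateWins_rename_iff (q : ℕ) (s : State K) :
    InScopeStateWins q (s.rename e) ↔ InScopeStateWins q s := by
  refine ⟨fun h => ?_, inScopeStateWins_rename e q⟩
  have h' := inScopeStateWins_rename e.symm q h
  rwa [Equivariance.rename_rename_symm] at h'

/-- A set of states NOT in the F4-C attractor renames to such a set (trap reading). [folklore] -/
theorem not_inScopeStateWins_rename_iff (q : ℕ) (s : State K) :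
    ¬ InScopeStateWins q (s.rename e) ↔ ¬ InScopeStateWins q s :=
  (inScopeStateWins_rename_iff e q s).not

end Attractor

section Descent

variable {k : Type} [Field k] [DecidableEq k] [DecidableEq K] (f : k →+* K) (q : ℕ)

open InScopeWinCert

/-- **The F4-C attractor DESCENDS**: if the extended state `(F ⊗ K, r, exc)` is in-scope escapable over `K`,
the state is in-scope escapable over `k` — legality transfers both ways («in scope» and «permissible» are
geometric), B's `k`-rational answers are among its `K`-rational ones. [folklore] -/
theorem inScopeStateWins_of_inScopeStateWins_map {s : State k}
    (h : InScopeStateWins q (⟨MvPolynomial.map f s.F, s.r, s.exc⟩ : State K)) : InScopeStateWins q s := by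
  unfold InScopeStateWins at h ⊢
  generalize hx : (⟨MvPolynomial.map f s.F, s.r, s.exc⟩ : State K) = x at h
  induction h generalizing s with
  | @terminal x hx' =>
    subst hx
    exact Game.Wins.terminal fun S hS =>
      hx' S ⟨ScopeBaseChange.inCoordinateScope_map f hS.1,
        (BaseChange.isPermissibleCentre_map_iff f q S s.F).mpr hS.2⟩
  | @move x S hS _ ih =>
    subst hx
    exact Game.Wins.move (m := S)
      ⟨ScopeDescent.inCoordinateScope_of_map f hS.1, (BaseChange.isPermissibleCentre_map_iff f q S s.F).mp hS.2⟩
      fun t ht => ih _ (BaseChange.edge_map f ht) rfl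

/-- Contrapositive: a state outside the F4-C attractor stays outside in every extension (an in-scope trap
over `𝔽₂` kills F4-C over every field containing it). [folklore] -/
theorem not_inScopeStateWins_map_of_not {s : State k} (h : ¬ InScopeStateWins q s) :
    ¬ InScopeStateWins q (⟨MvPolynomial.map f s.F, s.r, s.exc⟩ : State K) :=
  fun h' => h (inScopeStateWins_of_inScopeStateWins_map f q h')

end Descent

section Isolated

variable [DecidableEq K]

/-- **F4-I kill certificates mod `S₄`**: an isolated `Step0` chain renames to an isolated `Step0` chain.
[folklore] -/
theorem isolatedChain_rename (q : ℕ) {c : ℕ → State K}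
    (hc : ∀ n, IsIsolated q (c n).F ∧ Step0 q (c n) (c (n + 1))) :
    ∀ n, IsIsolated q ((c n).rename e).F ∧ Step0 q ((c n).rename e) ((c (n + 1)).rename e) := fun n =>
  ⟨(isIsolated_rename_iff e q (c n).F).mpr (hc n).1, Equivariance.step0_rename e (hc n).2⟩

end Isolated

end ScopeSymmetry

end Summit.ResolutionOfSingularities.ResolutionOfSingularities.Theorems.PIDim4

end
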